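import Literature.NumberTheory.Automorphic.ConjugationProperOnEllipticNeighbourhood      -- FILE 2: `UnitaryGroupOfForm.exists_nhds_isCompact_forall_conj_mem_of_isCompact_centralizer`
import Literature.NumberTheory.Automorphic.ConjugationProperOnRegularCompactaLocal      -- ★ (ii′)-TRANSPORT template: `localNonsplitEquiv` plumbing, regularity bridge, hermitian ∕ involution letters
import Literature.NumberTheory.Automorphic.AdicCompletionCompact                        -- ★ `properSpace_adicCompletion`
import HarnessLib

/-!
# Uniform compactness at a `G`-neighbourhood of a regular element with compact centraliser, TRANSPORTED to `U(J)(F_v)` at a non-split place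

Topic `NumberTheory/Automorphic`; namespace `Literature.NumberTheory.Automorphic.UnitaryGroup`. THEOREMS ONLY (no definition, no instance, no notation, no
named fact, no `sorry`). Cell `pub/hodgecm-mathlib`, generic base-layer brick «ELL-READING (UC)-G LOCAL» (FILE 3 of the generic part of census HC-SC v1 §2 E2-4;
count-neutral, no road implied): ★ FILE 2's `U(σ, J)(E)`-level head `UnitaryGroupOfForm.exists_nhds_isCompact_forall_conj_mem_of_isCompact_centralizer` read at
the tree's local unitary groups `«local» E c N J v` (= `(cmDatum L N H).Local v` for a CM field) BY NAME through the one-place model ★ `localNonsplitEquiv :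
U(J)(F_v) ≃ₜ* U(σ_w, J_w)(E_w)` (`w ∣ v`, `c • w = w`) — the same transport, token for token, as ★ `ConjugationProperOnRegularCompactaLocal` does for the
torus-directional (ii′).

* `UnitaryGroup.exists_nhds_isCompact_forall_conj_mem_local_of_nonsplit_of_isCompact_centralizer` — for `γ ∈ U(J)(F_v)` regular semisimple with COMPACT
  centraliser and a compact `C`: `∃ C₀ ∈ 𝓝 γ, ∃ S compact, ∀ g ∈ C₀, ∀ x, x g x⁻¹ ∈ C → x ∈ S` (instances pinned as in the template: `E_w` a complete
  non-trivially normed field via Mathlib `Valued.toNontriviallyNormedField`, proper by ★ `properSpace_adicCompletion`, `CharZero`, `GL_N(E_w)` σ-compact);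
* the CM spelling `UnitaryGroup.exists_nhds_isCompact_forall_conj_mem_cmDatum_local_of_isCompact_centralizer` and the SUPPORT form
  `UnitaryGroup.exists_isOpen_isCompact_forall_apply_conj_eq_zero_cmDatum_local_of_isCompact_centralizer` (= hypothesis (UC) `hS ∕ hCS` of ★ FILE 1
  `CoefficientOrbitalFunctionEllipticReading.eq_mul_integral_conj_of_forall_setIntegral_eq` at `G = (cmDatum L N H).Local v`).
NOT HERE: split places; the compactness of `Z(γ)` at an elliptic regular class (ELL-TOR letters); the reading at the datum (census E2-4 proper).
HONEST LABEL: HC_CM is proved only modulo the printed citations until rung 0 closes; this file is topology and pays nothing by itself.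

## References
* [HarishChandra1970] Harish-Chandra (notes by G. van Dijk), *Harmonic Analysis on Reductive p-adic Groups*, LNM 162 (1970), Part V §4 Lemma 23, Theorem 12 (pp. 57–62).
* [Rogawski1990] J. D. Rogawski, *Automorphic Representations of Unitary Groups in Three Variables*, Ann. of Math. Stud. 123 (1990), §4.9 p. 54; §3.1 p. 19.
* [PlatonovRapinchuk1994] V. Platonov, A. Rapinchuk, *Algebraic Groups and Number Theory* (1994), §5.1 (the one-place model of `U(J)(F_v)` at a non-split place).
-/

set_option autoImplicit false

noncomputable section

open Set Filter Topology NumberField IsDedekindDomain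
open Literature.MeasureTheory.Group
open scoped Matrix MatrixGroups Pointwise

namespace Literature.NumberTheory.Automorphic

namespace UnitaryGroup

open Literature.NumberTheory.Rogawski1990 (IsRegularElt)

section Local

variable {F E : Type} [Field F] [NumberField F] [Field E] [NumberField E] [Algebra F E] [Algebra.IsQuadraticExtension F E]
  (c : E ≃ₐ[F] E) (N : ℕ) (J : Matrix (Fin N) (Fin N) E) {v : HeightOneSpectrum (𝓞 F)} (hc : c ≠ 1)
  (hJ : (J.map c)ᵀ = J) (hJd : IsUnit J.det)

include hc hJ hJd in
/-- **HARISH-CHANDRA'S UNIFORM COMPACTNESS AT A `G`-NEIGHBOURHOOD, `U(J)(F_v)` AT A NON-SPLIT PLACE** (`w ∣ v`, `c • w = w`; `J` `c`-hermitian with unit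
determinant). For `γ ∈ U(J)(F_v)` regular semisimple with COMPACT centraliser and a compact `C ⊆ U(J)(F_v)`: there are a neighbourhood `C₀` of `γ` and ONE
compact `S` with `x g x⁻¹ ∈ C`, `g ∈ C₀` ⇒ `x ∈ S` — ★ FILE 2's `U(σ_w, J_w)(E_w)` head through ★ `localNonsplitEquiv` (`C₀ = e⁻¹ C₀′`, `S = e⁻¹ S′`,
`Z(e γ) = e Z(γ)`). [cite: HarishChandra1970, Part V §4 Lemma 23, Thm. 12 (pp. 57–62)] [cite: Rogawski1990, §4.9 p. 54; §3.1 p. 19] [cite: PlatonovRapinchuk1994, §5.1] -/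
theorem exists_nhds_isCompact_forall_conj_mem_local_of_nonsplit_of_isCompact_centralizer (w : PlacesOver E v) (hw : c • w.1 = w.1)
    [LocallyCompactSpace (GL (Fin N) (w.1.adicCompletion E))] [SecondCountableTopology (GL (Fin N) (w.1.adicCompletion E))]
    (γ : «local» E c N J v) (hγ : IsRegularElt (γ : GL (Fin N) (LocalRing E v)))
    (hZ : IsCompact (Subgroup.centralizer ({γ} : Set («local» E c N J v)) : Set («local» E c N J v)))
    {C : Set («local» E c N J v)} (hC : IsCompact C) :
    ∃ C₀ ∈ 𝓝 γ, ∃ S : Set («local» E c N J v), IsCompact S ∧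
      ∀ g ∈ C₀, ∀ x : «local» E c N J v, x * g * x⁻¹ ∈ C → x ∈ S := by
  letI : NontriviallyNormedField (w.1.adicCompletion E) :=
    Valued.toNontriviallyNormedField (w.1.adicCompletion E) (WithZero (Multiplicative ℤ))
  haveI : CharZero (w.1.adicCompletion E) := charZero_of_injective_algebraMap (algebraMap E (w.1.adicCompletion E)).injective
  haveI : SigmaCompactSpace (GL (Fin N) (w.1.adicCompletion E)) := sigmaCompactSpace_of_locallyCompact_secondCountable
  haveI : ProperSpace (w.1.adicCompletion E) := properSpace_adicCompletion E w.1
  set e := localNonsplitEquiv c J hc w hw with he_def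
  have hσσ : ∀ x, galAdicCompletionMap (L := E) c hw (galAdicCompletionMap (L := E) c hw x) = x :=
    galAdicCompletionMap_galAdicCompletionMap_of_smul_eq c w hc hw
  have hJw : ((placeForm J w.1).map (galAdicCompletionMap (L := E) c hw))ᵀ = placeForm J w.1 :=
    placeForm_hermitian_of_smul_eq c w J hJ hw
  have hγ' := charpoly_separable_localNonsplitEquiv_of_isRegularElt c N J hc γ w hw hγ
  have hC' : IsCompact ((e : «local» E c N J v → _) '' C) := hC.image e.continuous
  -- `Z(e γ) = e Z(γ)` is compact
  have hZ' : IsCompact (Subgroup.centralizer ({e γ} : Set (unitaryGroupOfForm (galAdicCompletionMap (L := E) c hw) (placeForm J w.1))) :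
      Set (unitaryGroupOfForm (galAdicCompletionMap (L := E) c hw) (placeForm J w.1))) := by
    have hset : (Subgroup.centralizer ({e γ} : Set (unitaryGroupOfForm (galAdicCompletionMap (L := E) c hw) (placeForm J w.1))) : Set _) =
        (e : «local» E c N J v → _) '' (Subgroup.centralizer ({γ} : Set («local» E c N J v)) : Set («local» E c N J v)) := by
      ext t'
      constructor
      · intro ht'
        refine ⟨e.symm t', ?_, e.apply_symm_apply t'⟩
        have h := (forall_apply_mem_centralizer_singleton_iff_of_eq e.toMulEquiv (γ := γ) rfl (e.symm t')).1
        apply h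
        show e (e.symm t') ∈ _
        rw [e.apply_symm_apply]
        exact ht'
      · rintro ⟨t, ht, rfl⟩
        exact (forall_apply_mem_centralizer_singleton_iff_of_eq e.toMulEquiv (γ := γ) rfl t).2 ht
    rw [hset]
    exact hZ.image e.continuous
  obtain ⟨C₀', hC₀', S', hS', h'⟩ :=
    UnitaryGroupOfForm.exists_nhds_isCompact_forall_conj_mem_of_isCompact_centralizer (m := N) (continuous_galAdicCompletionMap E c hw) hσσ hJw
      ((Matrix.isUnit_iff_isUnit_det _).1 (isUnit_placeForm_of_isUnit_det hJd w.1)) (e γ) hγ' hZ' hC'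
  refine ⟨(e : «local» E c N J v → _) ⁻¹' C₀', e.continuous.continuousAt.preimage_mem_nhds hC₀', e.symm '' S', hS'.image e.symm.continuous,
    fun g hg x hx => ?_⟩
  have hx' : e x * e g * (e x)⁻¹ ∈ (e : «local» E c N J v → _) '' C := ⟨_, hx, by rw [map_mul, map_mul, map_inv]⟩
  exact ⟨e x, h' (e g) hg (e x) hx', e.symm_apply_apply x⟩

end Local

section CM

variable (L : Type) [Field L] [NumberField L] [IsCMField L] (N : ℕ) (H : Matrix (Fin N) (Fin N) L)
  (hH : (H.map (cmConjRingHom L))ᵀ = H) (hHd : IsUnit H.det) {v : HeightOneSpectrum (𝓞 ↥(maximalRealSubfield L))}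

include hH hHd in
/-- **The CM spelling**: `G′_v = (cmDatum L N H).Local v`, `H` hermitian with unit determinant, `v` non-split (`w ∣ v`, `c • w = w`), `γ` regular semisimple with
COMPACT centraliser, `C` compact ⇒ `∃ C₀ ∈ 𝓝 γ, ∃ S compact, ∀ g ∈ C₀, ∀ x, x g x⁻¹ ∈ C → x ∈ S`.
[cite: HarishChandra1970, Part V §4 Lemma 23, Thm. 12 (pp. 57–62)] [cite: Rogawski1990, §4.9 p. 54; §3.1 p. 19] -/
theorem exists_nhds_isCompact_forall_conj_mem_cmDatum_local_of_isCompact_centralizer (w : PlacesOver L v) (hw : IsCMField.complexConj L • w.1 = w.1)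
    [LocallyCompactSpace (GL (Fin N) (w.1.adicCompletion L))] [SecondCountableTopology (GL (Fin N) (w.1.adicCompletion L))]
    (γ : (cmDatum L N H).Local v) (hγ : IsRegularElt (γ.val : GL (Fin N) (LocalRing L v)))
    (hZ : IsCompact (Subgroup.centralizer ({γ} : Set ((cmDatum L N H).Local v)) : Set ((cmDatum L N H).Local v)))
    {C : Set ((cmDatum L N H).Local v)} (hC : IsCompact C) :
    ∃ C₀ ∈ 𝓝 γ, ∃ S : Set ((cmDatum L N H).Local v), IsCompact S ∧
      ∀ g ∈ C₀, ∀ x : (cmDatum L N H).Local v, x * g * x⁻¹ ∈ C → x ∈ S :=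
  exists_nhds_isCompact_forall_conj_mem_local_of_nonsplit_of_isCompact_centralizer (IsCMField.complexConj L) N H (IsCMField.complexConj_ne_one L)
    (by rw [← map_cmConjRingHom_eq_map_complexConj L H]; exact hH) hHd w hw γ hγ hZ hC

include hH hHd in
/-- **The SUPPORT form at `G′_v = (cmDatum L N H).Local v`** — exactly the hypothesis (UC) `hC₀ ∕ hγ₀ ∕ hS ∕ hCS` of ★
`CoefficientOrbitalFunctionEllipticReading.eq_mul_integral_conj_of_forall_setIntegral_eq`: for `u : G′_v → Y` supported in a compact `C` and `γ` regular semisimple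
with compact centraliser, an OPEN `C₀ ∋ γ` and a compact `S` with `u(x g x⁻¹) = 0` for `g ∈ C₀`, `x ∉ S`.
[cite: HarishChandra1970, Part V §4 Lemma 23 (pp. 57–62)] [cite: Rogawski1990, §12.6 p. 187] -/
theorem exists_isOpen_isCompact_forall_apply_conj_eq_zero_cmDatum_local_of_isCompact_centralizer (w : PlacesOver L v)
    (hw : IsCMField.complexConj L • w.1 = w.1)
    [LocallyCompactSpace (GL (Fin N) (w.1.adicCompletion L))] [SecondCountableTopology (GL (Fin N) (w.1.adicCompletion L))]
    (γ : (cmDatum L N H).Local v) (hγ : IsRegularElt (γ.val : GL (Fin N) (LocalRing L v)))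
    (hZ : IsCompact (Subgroup.centralizer ({γ} : Set ((cmDatum L N H).Local v)) : Set ((cmDatum L N H).Local v)))
    {Y : Type*} [Zero Y] {u : (cmDatum L N H).Local v → Y} {C : Set ((cmDatum L N H).Local v)} (hC : IsCompact C)
    (huC : Function.support u ⊆ C) :
    ∃ C₀ : Set ((cmDatum L N H).Local v), IsOpen C₀ ∧ γ ∈ C₀ ∧ ∃ S : Set ((cmDatum L N H).Local v), IsCompact S ∧
      ∀ g ∈ C₀, ∀ x : (cmDatum L N H).Local v, x ∉ S → u (x * g * x⁻¹) = 0 := by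
  obtain ⟨C₁, hC₁, S, hS, hconj⟩ :=
    exists_nhds_isCompact_forall_conj_mem_cmDatum_local_of_isCompact_centralizer L N H hH hHd w hw γ hγ hZ hC
  obtain ⟨C₀, hC₀C₁, hC₀o, hγC₀⟩ := _root_.mem_nhds_iff.1 hC₁
  refine ⟨C₀, hC₀o, hγC₀, S, hS, fun g hg x hx => ?_⟩
  by_contra h
  exact hx (hconj g (hC₀C₁ hg) x (huC h))

end CM

end UnitaryGroup

end Literature.NumberTheory.Automorphic

end
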